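import Literature.AlgebraicGeometry.GroupSchemes.GeneralLinearGroupActionProjectiveSpaceScheme
import Literature.AlgebraicGeometry.Morphisms.ProjectiveFramePointsOfOneChart
import HarnessLib

/-!
# The action of `GL_{n+1,S}` on `𝐏ⁿ_S` read on `T`-valued points landing in one chart: `g · [θ] = [g θ]`

Topic `AlgebraicGeometry/GroupSchemes`; namespace `Literature.AlgebraicGeometry.GroupSchemes.GeneralLinearGroupScheme`
(the namespace of the action files).  THEOREMS ONLY (no definition, no named fact, no instance, no `sorry`;
one `attribute [local instance] MvPolynomial.gradedAlgebra`, tree precedent).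

[GortzWedhorn2020] Definition 4.44 (p. 117): an action `a : G ×_S X → X` is read on `T`-valued points,
`a(T) : G(T) × X(T) → X(T)`; Example 4.43 (1) (p. 116): `GL_n(T) = GL_n(Γ(T, 𝒪_T))`; Section (13.8): points of
`ℙⁿ` with values in a ring given by vectors with a unit coordinate.  [Hartshorne1977] II Example 7.1.1
(p. 151): an invertible matrix `‖a_{ij}‖` acts on `𝐏ⁿ_A` by `x_i' = Σ_j a_{ij} x_j`, i.e. on points by the
transformed homogeneous coordinates; II Thm. 7.1: a morphism to `𝐏ⁿ` is its sections `sᵢ = φ^*(xᵢ)`.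

The tree has the action morphism `act I S : GL_{n+1,S} ×_S 𝐏ⁿ_S ⟶ 𝐏ⁿ_S` (B-p11,
`GroupSchemes/GeneralLinearGroupActionProjectiveSpaceScheme`) with its intrinsic point formula
`comp_act_left_snd_eq` («the `𝐏ⁿ_ℤ`-component of `f ≫ act` is the core at `pointsOver Z (f ≫ fst)` after the
point `(unit, q)` of `Proj Γ(Z, 𝒪_Z)[x]`»), the action on coordinate vectors
(`GroupSchemes/GeneralLinearGroupActionOnCoordinates.vecPoint_comp_projLinAut`: `[θ] · g = [g θ]` for RING-valued
points) and the dictionary between `T`-valued points landing in one chart and their coordinate vectors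
`θ ∈ Γ(T, 𝒪_T)^{n+1}` (`Morphisms/ProjectiveFramePointsOfOneChart.coordPoint`, `eq_coordPoint`).  This file
assembles them:

* § 1 `lift_toSpecΓ_coordPoint` — brick A's pairing `(unit, [θ]) : T → Proj Γ(T, 𝒪_T)[x] ≅ Spec Γ × 𝐏ⁿ_ℤ` of the
  unit `T → Spec Γ(T, 𝒪_T)` with the point `[θ]` IS the `Γ(T, 𝒪_T)`-valued point `[θ]` of `ℙⁿ_{Γ(T,𝒪_T)}` after the
  unit; `eq_coordPoint_int` — over `ℤ` every `T`-point landing in one chart is `coordPoint` of its coordinates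
  (no compatibility hypothesis: ring maps out of `ℤ` are unique);
* § 2 **`lift_act_left_snd_eq_coordPoint`** — THE ACTION ON `T`-VALUED POINTS: for `g : Z → GL_{n+1,S}` with
  matrix `M = pointsOver Z g ∈ GL_{n+1}(Γ(Z, 𝒪_Z))` and a point `p : Z → 𝐏ⁿ_S` landing in the chart `D₊(x_a)`
  with coordinate vector `θ` (`θ_a = 1`), if `(M θ)_b` is a unit then the `𝐏ⁿ_ℤ`-component of `(g, p) ≫ act`
  is `coordPoint (M θ) b` — it lands in `D₊(x_b)` (`preU_lift_act_left_snd`) with chart coordinates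
  `(M θ)ᵢ (M θ)_b⁻¹` (`rs_homRatio_lift_act_left_snd`);
* § 3 the tuple form in the currency of `Morphisms/ProjectiveFrameLocus` (`d + 2` points of `𝐏ᵈ`, chart
  choices `c`, `c'`): **`topCoord_lift_act`** — the global coordinates of the acted tuple are the vectors
  `M θ_j` normalised at `c' j`.

Both chart hypotheses (`a` for the point, `b` for its image) are needed over a general base: they hold
Zariski-locally on `Z`, which is how F-8 (8b) uses the statement.  Cell `hodgecm-mathlib` (D-0151), F-DAG
F-8 (8b) bookkeeping, item (ε3b-2).  COUNT-NEUTRAL capital: HC_CM is proved only modulo the 7 printed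
citations until rung 0 closes; this file discharges none of them.

## References
* [GortzWedhorn2020] U. Görtz, T. Wedhorn, *Algebraic Geometry I: Schemes*, 2nd ed. (2020): Definition 4.44
  (p. 117), Example 4.43 (1) (p. 116), Section (4.12) (p. 113), Section (13.8).
* [Hartshorne1977] R. Hartshorne, *Algebraic Geometry* (1977): II Example 7.1.1 (p. 151), II Thm. 7.1.
-/

noncomputable section

-- Mathlib's pull-back / product API is stated through `abbrev`s over `limit`; as in Mathlib's own algebraic-geometry
-- files and the tree's action files we let `simp`/unification see through them.
set_option backward.isDefEq.respectTransparency false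

universe u

open CategoryTheory CategoryTheory.Limits AlgebraicGeometry MonoidalCategory CartesianMonoidalCategory
  HomogeneousLocalization Matrix
open MvPolynomial (X)
open Literature.AlgebraicGeometry.Morphisms (intU projectiveSpaceInt projectiveSpace projectiveSpaceFst
  isPullback_projToSpec_projMap_terminal)
open Literature.AlgebraicGeometry.Motives.ProjBaseChangeRing (mapGraded irrelevant_le_map projToSpec)
open Literature.AlgebraicGeometry.Motives.Segre
open Literature.AlgebraicGeometry.Motives.GeneratingSections
open Literature.AlgebraicGeometry.GroupSchemes.ProjLinAction (projLinAut vecPoint vecPoint_comp_projLinAut)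
open Literature.AlgebraicGeometry.Morphisms.ProjFrame (coordPoint coordPoint_congr preU_coordPoint
  rs_homRatio_coordPoint eq_coordPoint vecPoint_comp_toSpec toSpecΓ_comp_vecPoint_comp_projMap topCoord topCoord_self)

attribute [local instance] MvPolynomial.gradedAlgebra

namespace Literature.AlgebraicGeometry.GroupSchemes.GeneralLinearGroupScheme

variable (I : Type u)

/-! ### § 1 Brick A's pairing of the unit with a point given by a coordinate vector -/

section Lift

variable {T : Scheme.{u}}

/-- Ring homomorphisms out of `ULift ℤ` agree. [folklore] -/
private theorem ringHom_intU_ext' {A : Type u} [CommRing A] (f g : intU.{u} →+* A) : f = g := by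
  have h : f.comp ULift.ringEquiv.{0, u}.symm.toRingHom = g.comp ULift.ringEquiv.symm.toRingHom :=
    Subsingleton.elim _ _
  exact RingHom.ext fun x => RingHom.congr_fun h x.down

/-- Over `ℤ` the compatibility hypothesis of `ProjFrame.eq_coordPoint` is automatic: **every `T`-valued
point of `𝐏ⁿ_ℤ` landing in the chart `D₊(x_a)` is `coordPoint` of its coordinate vector
`θᵢ = q^*(xᵢ/x_a)`** (Hartshorne II Thm. 7.1 (b), one chart). [cite: Hartshorne1977, II Thm. 7.1 (b)] -/
theorem eq_coordPoint_int [Algebra intU.{u} Γ(T, ⊤)] (q : T ⟶ projectiveSpaceInt I)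
    (a : Fin (Nat.card I + 1)) (ha : preU q a = ⊤) (θ : Fin (Nat.card I + 1) → Γ(T, ⊤))
    (hθq : ∀ i, rs ha.ge (homRatio q a i) = θ i) (hθ : IsUnit (θ a)) :
    q = coordPoint intU.{u} θ a hθ :=
  eq_coordPoint q a ha θ hθq hθ (ringHom_intU_ext' _ _)

/-- **Brick A's pairing `(unit, [θ])` is the `Γ(T, 𝒪_T)`-point `[θ]` after the unit**: for a `T`-point
`q = coordPoint θ a` of `𝐏ⁿ_ℤ`, the morphism `T → Proj Γ(T, 𝒪_T)[x]` induced by `(T → Spec Γ(T, 𝒪_T), q)` on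
`Proj Γ[x] ≅ Spec Γ × 𝐏ⁿ_ℤ` (`Morphisms/ProjectiveSpaceOverAffine`) is `T → Spec Γ(T, 𝒪_T)` followed by
`ProjLinAction.vecPoint θ` (Görtz–Wedhorn (4.12): `ℙⁿ_{Spec R} = ℙⁿ_R`; (13.8)).
[cite: GortzWedhorn2020, Section (4.12) (p. 113)] -/
theorem lift_toSpecΓ_coordPoint [Algebra intU.{u} Γ(T, ⊤)] (q : T ⟶ projectiveSpaceInt I)
    (θ : Fin (Nat.card I + 1) → Γ(T, ⊤)) (a : Fin (Nat.card I + 1)) (hθ : IsUnit (θ a))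
    (hq : q = coordPoint intU.{u} θ a hθ) (h : IsUnit (MvPolynomial.eval θ (X a))) :
    (isPullback_projToSpec_projMap_terminal I Γ(T, ⊤)).lift T.toSpecΓ q (terminal.hom_ext _ _) =
      T.toSpecΓ ≫ vecPoint θ (X_mem Γ(T, ⊤) a) zero_lt_one h := by
  apply (isPullback_projToSpec_projMap_terminal I Γ(T, ⊤)).hom_ext
  · rw [IsPullback.lift_fst, Category.assoc]
    exact (Category.comp_id _).symm.trans
      (congrArg (T.toSpecΓ ≫ ·) (vecPoint_comp_toSpec θ (X_mem Γ(T, ⊤) a) zero_lt_one h).symm)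
  · rw [IsPullback.lift_snd, Category.assoc, toSpecΓ_comp_vecPoint_comp_projMap θ a hθ, hq]

end Lift

/-! ### § 2 The action on `T`-valued points landing in one chart -/

section Act

variable {S : Scheme.{u}} {Z : Over S}

/-- If two morphisms to `ℙ(ι)_k` are equal, their chart coordinates read on `q⁻¹ D₊(x_a) = T` agree
(transport of the proof-dependent restriction). [folklore] -/
private theorem rs_homRatio_congr {ι : Type} {k : Type u} [CommRing k] {T : Scheme.{u}}
    {q q' : T ⟶ Proj (grading ι k)} (e : q = q') {a : ι} (ha : preU q a = ⊤) (ha' : preU q' a = ⊤) (i : ι) :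
    rs ha.ge (homRatio q a i) = rs ha'.ge (homRatio q' a i) := by
  subst e
  rfl

/-- **THE ACTION ON `T`-VALUED POINTS, ONE CHART** (Görtz–Wedhorn Def. 4.44 `a(T) : G(T) × X(T) → X(T)` for
`act`, made explicit by Hartshorne II Example 7.1.1's change of coordinates): let `g : Z → GL_{n+1,S}` over `S`
with matrix `M = pointsOver Z g ∈ GL_{n+1}(Γ(Z, 𝒪_Z))`, and `p : Z → 𝐏ⁿ_S` over `S` whose `𝐏ⁿ_ℤ`-component `q`
lands in `D₊(x_a)` with coordinate vector `θ = (q^*(xᵢ/x_a))ᵢ`.  If `(M θ)_b` is a unit, the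
`𝐏ⁿ_ℤ`-component of `(g, p) ≫ act` is the point `coordPoint (M θ) b` with homogeneous coordinates `M θ`.
[cite: GortzWedhorn2020, Definition 4.44 (p. 117)] -/
theorem lift_act_left_snd_eq_coordPoint (g : Z ⟶ GLOver (Fin (Nat.card I + 1)) S) (p : Z ⟶ PS I S)
    (a b : Fin (Nat.card I + 1)) (θ : Fin (Nat.card I + 1) → Γ(Z.left, ⊤))
    (ha : preU (p.left ≫ pullback.snd (terminal.from S) (terminal.from (projectiveSpaceInt I))) a = ⊤)
    (hθq : ∀ i, rs ha.ge (homRatio (p.left ≫ pullback.snd (terminal.from S)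
      (terminal.from (projectiveSpaceInt I))) a i) = θ i)
    (hθ : IsUnit (θ a))
    (hb : IsUnit (((pointsOver Z g : Matrix _ _ Γ(Z.left, ⊤)) *ᵥ θ) b)) :
    letI : Algebra intU.{u} Γ(Z.left, ⊤) := (intCast _).toAlgebra
    (CartesianMonoidalCategory.lift g p ≫ act I S).left ≫
        pullback.snd (terminal.from S) (terminal.from (projectiveSpaceInt I)) =
      coordPoint intU.{u} ((pointsOver Z g : Matrix _ _ Γ(Z.left, ⊤)) *ᵥ θ) b hb := by
  letI : Algebra intU.{u} Γ(Z.left, ⊤) := (intCast _).toAlgebra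
  have ha' : IsUnit (MvPolynomial.eval θ (X a)) := by rwa [MvPolynomial.eval_X]
  have hb' : IsUnit (MvPolynomial.eval ((pointsOver Z g : Matrix _ _ Γ(Z.left, ⊤)) *ᵥ θ) (X b)) := by
    rwa [MvPolynomial.eval_X]
  have hq := eq_coordPoint_int I (p.left ≫ pullback.snd (terminal.from S)
    (terminal.from (projectiveSpaceInt I))) a ha θ hθq hθ
  rw [comp_act_left_snd_eq I (CartesianMonoidalCategory.lift g p)]
  simp only [lift_fst, lift_snd]
  rw [lift_toSpecΓ_coordPoint I _ θ a hθ hq ha', actCore_def, Category.assoc,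
    ← Category.assoc (vecPoint θ _ _ _) (projLinAut _).hom,
    vecPoint_comp_projLinAut (pointsOver Z g) θ a b ha' hb',
    toSpecΓ_comp_vecPoint_comp_projMap _ b hb]

/-- Hence the acted point lands in the chart `D₊(x_b)`. [cite: GortzWedhorn2020, Definition 4.44 (p. 117)] -/
theorem preU_lift_act_left_snd (g : Z ⟶ GLOver (Fin (Nat.card I + 1)) S) (p : Z ⟶ PS I S)
    (a b : Fin (Nat.card I + 1)) (θ : Fin (Nat.card I + 1) → Γ(Z.left, ⊤))
    (ha : preU (p.left ≫ pullback.snd (terminal.from S) (terminal.from (projectiveSpaceInt I))) a = ⊤)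
    (hθq : ∀ i, rs ha.ge (homRatio (p.left ≫ pullback.snd (terminal.from S)
      (terminal.from (projectiveSpaceInt I))) a i) = θ i)
    (hθ : IsUnit (θ a))
    (hb : IsUnit (((pointsOver Z g : Matrix _ _ Γ(Z.left, ⊤)) *ᵥ θ) b)) :
    preU ((CartesianMonoidalCategory.lift g p ≫ act I S).left ≫
        pullback.snd (terminal.from S) (terminal.from (projectiveSpaceInt I))) b = ⊤ := by
  letI : Algebra intU.{u} Γ(Z.left, ⊤) := (intCast _).toAlgebra
  rw [lift_act_left_snd_eq_coordPoint I g p a b θ ha hθq hθ hb]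
  exact preU_coordPoint _ b hb

/-- … with chart coordinates `(M θ)ᵢ · (M θ)_b⁻¹` («the point with the transformed homogeneous
coordinates», Hartshorne II Example 7.1.1). [cite: Hartshorne1977, II Example 7.1.1 (p. 151)] -/
theorem rs_homRatio_lift_act_left_snd (g : Z ⟶ GLOver (Fin (Nat.card I + 1)) S) (p : Z ⟶ PS I S)
    (a b : Fin (Nat.card I + 1)) (θ : Fin (Nat.card I + 1) → Γ(Z.left, ⊤))
    (ha : preU (p.left ≫ pullback.snd (terminal.from S) (terminal.from (projectiveSpaceInt I))) a = ⊤)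
    (hθq : ∀ i, rs ha.ge (homRatio (p.left ≫ pullback.snd (terminal.from S)
      (terminal.from (projectiveSpaceInt I))) a i) = θ i)
    (hθ : IsUnit (θ a))
    (hb : IsUnit (((pointsOver Z g : Matrix _ _ Γ(Z.left, ⊤)) *ᵥ θ) b)) (i : Fin (Nat.card I + 1)) :
    rs (preU_lift_act_left_snd I g p a b θ ha hθq hθ hb).ge
        (homRatio ((CartesianMonoidalCategory.lift g p ≫ act I S).left ≫
          pullback.snd (terminal.from S) (terminal.from (projectiveSpaceInt I))) b i) =
      ((pointsOver Z g : Matrix _ _ Γ(Z.left, ⊤)) *ᵥ θ) i * ((hb.unit⁻¹ : (Γ(Z.left, ⊤))ˣ) : Γ(Z.left, ⊤)) := by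
  letI : Algebra intU.{u} Γ(Z.left, ⊤) := (intCast _).toAlgebra
  rw [rs_homRatio_congr (lift_act_left_snd_eq_coordPoint I g p a b θ ha hθq hθ hb)
    (preU_lift_act_left_snd I g p a b θ ha hθq hθ hb) (preU_coordPoint _ b hb)]
  exact rs_homRatio_coordPoint _ b hb i

end Act

/-! ### § 3 Tuples of points read in chart choices (the currency of `Morphisms/ProjectiveFrameLocus`) -/

section Tuple

variable {S : Scheme.{u}} {Z : Over S}

/-- **The action on a tuple of `Z`-valued points of `𝐏ⁿ_S` read in chart choices, charts**: if the
`𝐏ⁿ_ℤ`-components of the `n + 2` points `φ j` land in the charts `D₊(x_{c j})` with global coordinate vectors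
`θ_j = topCoord _ c _ j`, and the vectors `M θ_j` (`M = pointsOver Z g`) have unit `c' j`-th coordinates, then the
acted points `(g, φ j) ≫ act` land in the charts `D₊(x_{c' j})` … [cite: GortzWedhorn2020, Definition 4.44 (p. 117)] -/
theorem preU_lift_act (g : Z ⟶ GLOver (Fin (Nat.card I + 1)) S) (φ : Fin (Nat.card I + 2) → (Z ⟶ PS I S))
    (c c' : Fin (Nat.card I + 2) → Fin (Nat.card I + 1))
    (hc : ∀ j, preU ((φ j).left ≫ pullback.snd (terminal.from S) (terminal.from (projectiveSpaceInt I)))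
      (c j) = ⊤)
    (hb : ∀ j, IsUnit (((pointsOver Z g : Matrix _ _ Γ(Z.left, ⊤)) *ᵥ
      topCoord (fun j => (φ j).left ≫ pullback.snd (terminal.from S) (terminal.from (projectiveSpaceInt I)))
        c hc j) (c' j))) (j : Fin (Nat.card I + 2)) :
    preU ((CartesianMonoidalCategory.lift g (φ j) ≫ act I S).left ≫
        pullback.snd (terminal.from S) (terminal.from (projectiveSpaceInt I))) (c' j) = ⊤ :=
  preU_lift_act_left_snd I g (φ j) (c j) (c' j)
    (topCoord (fun j => (φ j).left ≫ pullback.snd (terminal.from S) (terminal.from (projectiveSpaceInt I))) c hc j)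
    (hc j) (fun _ => rfl) (topCoord_self _ c hc j ▸ isUnit_one) (hb j)

/-- … **and their global coordinates are the vectors `M θ_j` normalised at `c' j`**:
`topCoord (acted tuple) c' _ j i = (M θ_j)ᵢ · ((M θ_j)_{c' j})⁻¹` — Hartshorne II Example 7.1.1's transformed
homogeneous coordinates, for `n + 2` points at once (the bookkeeping of MFK Ch. 3 Prop. 3.1's transporter on
`(P_n)^{n+2}`). [cite: Hartshorne1977, II Example 7.1.1 (p. 151)] -/
theorem topCoord_lift_act (g : Z ⟶ GLOver (Fin (Nat.card I + 1)) S) (φ : Fin (Nat.card I + 2) → (Z ⟶ PS I S))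
    (c c' : Fin (Nat.card I + 2) → Fin (Nat.card I + 1))
    (hc : ∀ j, preU ((φ j).left ≫ pullback.snd (terminal.from S) (terminal.from (projectiveSpaceInt I)))
      (c j) = ⊤)
    (hb : ∀ j, IsUnit (((pointsOver Z g : Matrix _ _ Γ(Z.left, ⊤)) *ᵥ
      topCoord (fun j => (φ j).left ≫ pullback.snd (terminal.from S) (terminal.from (projectiveSpaceInt I)))
        c hc j) (c' j))) (j : Fin (Nat.card I + 2)) (i : Fin (Nat.card I + 1)) :
    topCoord (fun j => (CartesianMonoidalCategory.lift g (φ j) ≫ act I S).left ≫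
        pullback.snd (terminal.from S) (terminal.from (projectiveSpaceInt I))) c' (preU_lift_act I g φ c c' hc hb)
        j i =
      ((pointsOver Z g : Matrix _ _ Γ(Z.left, ⊤)) *ᵥ
          topCoord (fun j => (φ j).left ≫ pullback.snd (terminal.from S) (terminal.from (projectiveSpaceInt I)))
            c hc j) i *
        (((hb j).unit⁻¹ : (Γ(Z.left, ⊤))ˣ) : Γ(Z.left, ⊤)) :=
  rs_homRatio_lift_act_left_snd I g (φ j) (c j) (c' j)
    (topCoord (fun j => (φ j).left ≫ pullback.snd (terminal.from S) (terminal.from (projectiveSpaceInt I))) c hc j)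
    (hc j) (fun _ => rfl) (topCoord_self _ c hc j ▸ isUnit_one) (hb j) i

end Tuple

end Literature.AlgebraicGeometry.GroupSchemes.GeneralLinearGroupScheme
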